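import Mathlib
import Summits.Langlands.Langlands.Theorems.PhantomRMYoshidaStableYoshidaCongruenceSector
import Summits.Langlands.Langlands.Theorems.PhantomRMYoshidaYoshidaResidualSp4Schur
import Summits.Langlands.Langlands.Theorems.PhantomRMYoshidaStableYoshidaCongruenceSymplecticFormFpAltInv
import HarnessLib

/-!
# Stub `stub_symplecticFormFp` (line `burkhardt-weddle-two-three-anchor`, crux stmt-Langlands-13640)

The registered stub of the checked skeleton `Cruxes/StableYoshidaCongruence/Lines/
burkhardt_weddle_two_three_anchor.lean` (lead c1), proved: for `p` odd, `k` algebraically closed of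
characteristic `p` (discrete), `σ, σ' : Γ_ℚ → GL₂(k)` irreducible, NON-CONJUGATE, with
`det σ = det σ' = ε̄⁻¹` (`DetCond`), and `ρb : Γ_ℚ → GL₄(𝔽_p)` an `𝔽_p`-model of `σ ⊕ σ'`
(`IsModelOf`), the model `ρb` is symplectic with multiplier `ε̄⁻¹` OVER `𝔽_p`
(`IsSymplecticWithMultiplierFun`, verbatim the first clause of LTWS `Switchable p k σ σ'`).

## Proof (BoxerEtAl2021 §2.1; Isaacs1976 Cor. 9.22)

"Invariant alternating form of multiplier `c` for `M`" means `Jᵀ = -J ∧ ∀ g, M(g)ᵀ J M(g) = c(g) • J`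
(spelled out; the linear algebra — transports, the descent lemma `mem_span_map_of_isAltInv`, the
`2 × 2` facts and the block forms `a J₂ ⊕ b J₂`, `J₂ = (0 1; -1 0)` — is in
`…SymplecticFormFpAltInv.lean`).
* `eq_bl_of_isAltInv` (Schur): an invariant alternating `X = (A B; C D)` on `k² ⊕ k²` for `σ ⊕ σ'`
  with multiplier `ν = det σ` has `σᵀ B σ' = ν B`, so `J₂ B` intertwines `σ'` into `σ`
  (`σ J₂ σᵀ = det σ • J₂`); Schur I (`det_ne_zero_of_intertwiner`) and non-conjugacy force
  `B = 0 = C`, and the alternating diagonal blocks are multiples of `J₂` (`2 ≠ 0`): `X = a J₂ ⊕ b J₂`.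
* `exists_isAltInv_det_ne_zero`: transporting through the conjugating matrix `h` of `IsModelOf` and
  the reindexing `Fin 2 ⊕ Fin 2 ≃ Fin 4` (`Ψ`), the invariant forms of `ρb ⊗ k` are the
  `Φ a b := Ψ (a J₂ ⊕ b J₂)`, of determinant `det(h⁻¹)² a² b²`; by descent they are `k`-combinations
  of images of `𝔽_p`-RATIONAL invariant forms; were all rational forms degenerate, their images would
  lie on the two lines `ab = 0`, additivity would confine them to ONE line, and one line does not
  contain both `Φ 1 0` and `Φ 0 1`.
* `stub_symplecticFormFp`: `K₀ = 𝔽_p`, `φ = ZMod.castHom`, `M₀ = ρb`, `c = ε̄⁻¹`; `DetCond` unfolds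
  to `det σ(g) = det σ'(g) = φ (ε̄(g)⁻¹)` and `IsModelOf` to
  `h⁻¹ (ρb(g) ⊗ k) h = reindex (σ(g) ⊕ σ'(g))`.
-/

set_option linter.dupNamespace false -- project-wide option; `Summit.Langlands.Langlands` is the mandated namespace

noncomputable section

open Literature.NumberTheory.GaloisRepresentations
open Summit.Langlands.Langlands.Cruxes.StableYoshidaCongruence.LevelThreeWeierstrassSwitch
open Summit.Langlands.Langlands.Theorems.PhantomRMYoshida (det_ne_zero_of_intertwiner
  exists_conj_of_intertwiner two_ne_zero_of_charP_ne_two)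
open scoped Matrix

namespace Summit.Langlands.Langlands.Cruxes.StableYoshidaCongruence.BurkhardtWeddleTwoThreeAnchor

section Blocks

variable {k : Type} [Field k] [TopologicalSpace k] [DiscreteTopology k]

/-! ## Schur: the invariant alternating forms on `σ ⊕ σ'` -/

/-- **The invariant alternating forms of multiplier `det σ` on `σ ⊕ σ'` are the `a J₂ ⊕ b J₂`**, for
`σ'` irreducible, `σ, σ'` non-conjugate and `2 ≠ 0`: the diagonal blocks are alternating `2 × 2`
matrices, hence multiples of `J₂ = (0 1; -1 0)`; the cross block `B` satisfies `σᵀ B σ' = det σ • B`,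
so `J₂ B` intertwines `σ'` into `σ` (`S J₂ Sᵀ = det S • J₂`), and Schur I plus non-conjugacy force
`B = 0`. [folklore] -/
theorem eq_bl_of_isAltInv (h2 : (2 : k) ≠ 0) (σ σ' : FramedGaloisRep ℚ k 2)
    (hirr' : σ'.toGaloisRep.IsIrreducible) (hnc : NonConj σ σ')
    {ν : Field.absoluteGaloisGroup ℚ → k} (hdetσ : ∀ g, (σ g).val.det = ν g)
    {X : Matrix (Fin 2 ⊕ Fin 2) (Fin 2 ⊕ Fin 2) k} (hXt : Xᵀ = -X)
    (hXg : ∀ g, (Matrix.fromBlocks (σ g).val 0 0 (σ' g).val)ᵀ * X *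
      Matrix.fromBlocks (σ g).val 0 0 (σ' g).val = ν g • X) :
    ∃ a b : k, X = Matrix.fromBlocks (a • !![0, 1; -1, 0]) 0 0 (b • !![0, 1; -1, 0]) := by
  obtain ⟨A, B, C, D, rfl⟩ : ∃ A B C D, X = Matrix.fromBlocks A B C D :=
    ⟨_, _, _, _, (Matrix.fromBlocks_toBlocks X).symm⟩
  rw [Matrix.fromBlocks_transpose, Matrix.fromBlocks_neg, Matrix.fromBlocks_inj] at hXt
  obtain ⟨hAt, -, hBt, hDt⟩ := hXt
  have hblk : ∀ g, (σ g).valᵀ * B * (σ' g).val = ν g • B := fun g => by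
    have h1 := hXg g
    simp only [Matrix.fromBlocks_transpose, Matrix.fromBlocks_multiply, Matrix.fromBlocks_smul,
      Matrix.transpose_zero, Matrix.zero_mul, Matrix.mul_zero, add_zero, zero_add,
      Matrix.fromBlocks_inj] at h1
    exact h1.2.1
  -- Schur I and non-conjugacy: the cross block vanishes
  have hB : B = 0 := by
    by_contra hB0
    set T : Matrix (Fin 2) (Fin 2) k := !![0, 1; -1, 0] * B with hT
    have hTne : T ≠ 0 := fun h0 => hB0 <| by
      rw [← Matrix.one_mul B, ← J₂_transpose_mul_J₂, Matrix.mul_assoc, ← hT, h0, Matrix.mul_zero]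
    have hint : ∀ g, T * (σ' g).val = (σ g).val * T := fun g => by
      have hd : (σ g).val.det ≠ 0 := Matrix.GeneralLinearGroup.det_ne_zero (σ g)
      refine ((smul_right_injective (Matrix (Fin 2) (Fin 2) k) hd) ?_).symm
      show (σ g).val.det • ((σ g).val * T) = (σ g).val.det • (T * (σ' g).val)
      calc (σ g).val.det • ((σ g).val * T)
          = (σ g).val * !![0, 1; -1, 0] * ((σ g).val.det • B) := by
            simp only [hT, Matrix.mul_smul, Matrix.mul_assoc]
        _ = (σ g).val * !![0, 1; -1, 0] * ((σ g).valᵀ * B * (σ' g).val) := by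
            rw [hdetσ g, ← hblk g]
        _ = (σ g).val * !![0, 1; -1, 0] * (σ g).valᵀ * B * (σ' g).val := by
            simp only [Matrix.mul_assoc]
        _ = (σ g).val.det • (T * (σ' g).val) := by
            rw [mul_J₂_mul_transpose]
            simp only [hT, Matrix.smul_mul, Matrix.mul_assoc]
    have hirr₂ : Representation.IsIrreducible
        ((Representation.ofDistribMulAction k (GL (Fin 2) k) (Fin 2 → k)).comp σ'.toMonoidHom) :=
      hirr'
    have hdet := det_ne_zero_of_intertwiner σ.toMonoidHom σ'.toMonoidHom hirr₂ hTne hint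
    obtain ⟨P, hP⟩ := exists_conj_of_intertwiner (fun x ↦ σ x) (fun x ↦ σ' x) hdet hint
    exact hnc ⟨P⁻¹, fun x ↦ by rw [← hP x]; group⟩
  have hC : C = 0 := by
    rw [hB, Matrix.transpose_zero] at hBt
    exact neg_eq_zero.mp hBt.symm
  refine ⟨A 0 1, D 0 1, ?_⟩
  rw [hB, hC, ← eq_smul_J₂_of_transpose_eq_neg h2 hAt, ← eq_smul_J₂_of_transpose_eq_neg h2 hDt]

/-! ## The core: a non-degenerate rational invariant form -/

/-- **Core of the stub.**  `σ, σ' : Γ_ℚ → GL₂(k)`, `σ'` irreducible, non-conjugate, of common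
determinant `φ ∘ c` (`c : Γ_ℚ → K₀`, `φ : K₀ → k` a field map), `2 ≠ 0` in `k`;
`M₀ : Γ_ℚ → M₄(K₀)` conjugate by `h ∈ GL₄(k)` to `σ ⊕ σ'` after `φ`.  Then some `K₀`-rational
`M₀`-invariant alternating matrix of multiplier `c` is non-degenerate: the invariant forms of
`M₀ ⊗ k` are the `Φ a b = Ψ (a J₂ ⊕ b J₂)` (`eq_bl_of_isAltInv` transported through `h` and the
reindexing), `det (Φ a b) = det(h⁻¹)² a² b²`, they are spanned by the images of the rational ones
(`mem_span_map_of_isAltInv`), and degenerate images lie on the two lines `ab = 0`, of which an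
additive image set meets essentially one — and one line does not span. [folklore] -/
theorem exists_isAltInv_det_ne_zero {K₀ : Type} [Field K₀] (φ : K₀ →+* k) (h2 : (2 : k) ≠ 0)
    (σ σ' : FramedGaloisRep ℚ k 2) (hirr' : σ'.toGaloisRep.IsIrreducible) (hnc : NonConj σ σ')
    (M₀ : Field.absoluteGaloisGroup ℚ → Matrix (Fin 4) (Fin 4) K₀)
    (c : Field.absoluteGaloisGroup ℚ → K₀)
    (hdetσ : ∀ g, (σ g).val.det = φ (c g)) (hdetσ' : ∀ g, (σ' g).val.det = φ (c g))
    (h : GL (Fin 4) k)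
    (hh : ∀ g, (h⁻¹ : GL (Fin 4) k).val * (M₀ g).map φ * h.val =
      Matrix.reindex finSumFinEquiv finSumFinEquiv (Matrix.fromBlocks (σ g).val 0 0 (σ' g).val)) :
    ∃ J₀ : Matrix (Fin 4) (Fin 4) K₀,
      (J₀ᵀ = -J₀ ∧ ∀ g, (M₀ g)ᵀ * J₀ * M₀ g = c g • J₀) ∧ J₀.det ≠ 0 := by
  classical
  set e : Fin 2 ⊕ Fin 2 ≃ Fin 4 := finSumFinEquiv
  set N₂ : Field.absoluteGaloisGroup ℚ → Matrix (Fin 2 ⊕ Fin 2) (Fin 2 ⊕ Fin 2) k :=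
    fun g => Matrix.fromBlocks (σ g).val 0 0 (σ' g).val
  -- the rational invariant forms `F₀` (a predicate) and the `k`-invariant forms `F`
  set F₀ : Matrix (Fin 4) (Fin 4) K₀ → Prop :=
    fun J₀ => J₀ᵀ = -J₀ ∧ ∀ g, (M₀ g)ᵀ * J₀ * M₀ g = c g • J₀
  set F : Matrix (Fin 4) (Fin 4) k → Prop :=
    fun J => Jᵀ = -J ∧ ∀ g, ((M₀ g).map φ)ᵀ * J * (M₀ g).map φ = φ (c g) • J
  show ∃ J₀, F₀ J₀ ∧ J₀.det ≠ 0
  have hinv : (h⁻¹ : GL (Fin 4) k).val * h.val = 1 := Units.inv_mul h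
  have hinv' : h.val * (h⁻¹ : GL (Fin 4) k).val = 1 := Units.mul_inv h
  have hNM : ∀ g, Matrix.reindex e e (N₂ g) = (h⁻¹ : GL (Fin 4) k).val * (M₀ g).map φ * h.val :=
    fun g => (hh g).symm
  have hMN : ∀ g, (M₀ g).map φ = h.val * Matrix.reindex e e (N₂ g) * (h⁻¹ : GL (Fin 4) k).val :=
    fun g => by
    rw [hNM]
    calc (M₀ g).map φ = (h.val * (h⁻¹ : GL (Fin 4) k).val) * (M₀ g).map φ *
          (h.val * (h⁻¹ : GL (Fin 4) k).val) := by rw [hinv', Matrix.one_mul, Matrix.mul_one]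
      _ = _ := by simp only [Matrix.mul_assoc]
  -- the transport `Ψ X = h⁻ᵀ (reindex X) h⁻¹`; the conjugated block forms `Φ a b = Ψ (a J₂ ⊕ b J₂)`
  set Ψ : Matrix (Fin 2 ⊕ Fin 2) (Fin 2 ⊕ Fin 2) k → Matrix (Fin 4) (Fin 4) k :=
    fun X => (h⁻¹ : GL (Fin 4) k).valᵀ * Matrix.reindex e e X * (h⁻¹ : GL (Fin 4) k).val with hΨ
  obtain ⟨Φ, hΦ⟩ : ∃ Φ : k → k → Matrix (Fin 4) (Fin 4) k, ∀ a b,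
      Φ a b = Ψ (Matrix.fromBlocks (a • !![0, 1; -1, 0]) 0 0 (b • !![0, 1; -1, 0])) :=
    ⟨_, fun _ _ => rfl⟩
  have hΦmem : ∀ a b, F (Φ a b) := fun a b => by
    rw [hΦ]
    exact conj_isAltInv hMN hinv ((reindex_isAltInv_iff e).mpr (bl_isAltInv hdetσ hdetσ' a b))
  have hΦeq : ∀ J, F J → ∃ a b, J = Φ a b := fun J hJ => by
    have hJ' := conj_isAltInv (P := (h⁻¹ : GL (Fin 4) k).val) (P' := h.val) hNM hinv' hJ
    obtain ⟨X, hX⟩ : ∃ X, Matrix.reindex e e X = h.valᵀ * J * h.val :=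
      ⟨(Matrix.reindex e e).symm _, Equiv.apply_symm_apply _ _⟩
    rw [← hX] at hJ'
    obtain ⟨hXt, hXg⟩ := (reindex_isAltInv_iff e).mp hJ'
    obtain ⟨a, b, hab⟩ := eq_bl_of_isAltInv h2 σ σ' hirr' hnc hdetσ hXt hXg
    refine ⟨a, b, ?_⟩
    rw [hΦ, ← hab, hΨ]
    dsimp only
    rw [hX, transpose_mul_sandwich, hinv', Matrix.transpose_one, Matrix.one_mul, Matrix.mul_one]
  have hΨdet : ∀ X, (Ψ X).det = ((h⁻¹ : GL (Fin 4) k).val.det) ^ 2 * X.det := fun X => by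
    simp only [hΨ, Matrix.det_mul, Matrix.det_transpose, Matrix.det_reindex_self]
    ring
  have hΦdet : ∀ a b, (Φ a b).det = ((h⁻¹ : GL (Fin 4) k).val.det) ^ 2 * (a ^ 2 * b ^ 2) :=
    fun a b => by rw [hΦ, hΨdet, det_bl]
  have hΦadd : ∀ a b a' b', Φ a b + Φ a' b' = Φ (a + a') (b + b') := fun a b a' b' => by
    simp only [hΦ, ← bl_add, hΨ, Matrix.reindex_apply, Matrix.submatrix_add, Pi.add_apply,
      Matrix.mul_add, Matrix.add_mul]
  have hΦsmul : ∀ t a b, t • Φ a b = Φ (t * a) (t * b) := fun t a b => by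
    simp only [hΦ, ← smul_bl, hΨ, Matrix.reindex_apply, Matrix.submatrix_smul, Pi.smul_apply,
      Matrix.mul_smul, Matrix.smul_mul]
  have hΦinj : ∀ a b a' b', Φ a b = Φ a' b' → a = a' ∧ b = b' := fun a b a' b' hab => by
    have hret : ∀ Z, h.valᵀ * Ψ Z * h.val = Matrix.reindex e e Z := fun Z => by
      simp only [hΨ]
      rw [transpose_mul_sandwich, hinv, Matrix.transpose_one, Matrix.one_mul, Matrix.mul_one]
    rw [hΦ, hΦ] at hab
    exact bl_inj ((Matrix.reindex e e).injective (by rw [← hret, ← hret, hab]))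
  have hdet_ne : (h⁻¹ : GL (Fin 4) k).val.det ≠ 0 := Matrix.GeneralLinearGroup.det_ne_zero _
  -- descent: the `k`-forms are spanned by the images of the `K₀`-rational forms
  have hspan : ∀ J, F J →
      J ∈ Submodule.span k ((fun J₀ : Matrix (Fin 4) (Fin 4) K₀ => J₀.map φ) '' {J₀ | F₀ J₀}) :=
    fun J hJ => mem_span_map_of_isAltInv φ M₀ c hJ.1 hJ.2
  -- if every rational form were degenerate …
  by_contra H
  push Not at H
  have H2 : ∀ J₀, F₀ J₀ → ∃ a b : k, J₀.map φ = Φ a b ∧ (a = 0 ∨ b = 0) := by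
    intro J₀ hJ₀
    obtain ⟨a, b, hab⟩ := hΦeq _ (map_isAltInv φ hJ₀)
    refine ⟨a, b, hab, ?_⟩
    have hd : (J₀.map φ).det = 0 := by
      rw [← RingHom.mapMatrix_apply, ← RingHom.map_det, H J₀ hJ₀, map_zero]
    rw [hab, hΦdet] at hd
    rcases mul_eq_zero.mp hd with h0 | h0
    · exact absurd h0 (pow_ne_zero _ hdet_ne)
    · rcases mul_eq_zero.mp h0 with ha | hb
      · exact Or.inl ((pow_eq_zero_iff two_ne_zero).mp ha)
      · exact Or.inr ((pow_eq_zero_iff two_ne_zero).mp hb)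
  -- … any subspace containing all their images would contain `Φ 1 0` and `Φ 0 1` …
  have hline : ∀ L : Submodule k (Matrix (Fin 4) (Fin 4) k),
      (∀ J₀, F₀ J₀ → J₀.map φ ∈ L) → Φ 1 0 ∈ L ∧ Φ 0 1 ∈ L := fun L hL => by
    have hle : Submodule.span k ((fun J₀ : Matrix (Fin 4) (Fin 4) K₀ => J₀.map φ) ''
        {J₀ | F₀ J₀}) ≤ L :=
      Submodule.span_le.mpr (by rintro _ ⟨J₀, hJ₀, rfl⟩; exact hL J₀ hJ₀)
    exact ⟨hle (hspan _ (hΦmem 1 0)), hle (hspan _ (hΦmem 0 1))⟩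
  -- … so some rational form maps onto the first line, off the origin, …
  have HA : ∃ J₀, F₀ J₀ ∧ ∃ a : k, a ≠ 0 ∧ J₀.map φ = Φ a 0 := by
    by_contra hcon
    push Not at hcon
    have hmem := (hline (k ∙ Φ 0 1) fun J₀ hJ₀ => by
      obtain ⟨a, b, hab, hab0⟩ := H2 J₀ hJ₀
      have ha : a = 0 := by
        by_contra ha
        exact hcon J₀ hJ₀ a ha (by rw [hab, hab0.resolve_left ha])
      rw [hab, ha, Submodule.mem_span_singleton]
      exact ⟨b, by rw [hΦsmul, mul_zero, mul_one]⟩).1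
    rw [Submodule.mem_span_singleton] at hmem
    obtain ⟨t, ht⟩ := hmem
    rw [hΦsmul, mul_zero, mul_one] at ht
    exact one_ne_zero (hΦinj _ _ _ _ ht).1.symm
  -- … and some rational form maps onto the second line, off the origin; …
  have HB : ∃ J₀, F₀ J₀ ∧ ∃ b : k, b ≠ 0 ∧ J₀.map φ = Φ 0 b := by
    by_contra hcon
    push Not at hcon
    have hmem := (hline (k ∙ Φ 1 0) fun J₀ hJ₀ => by
      obtain ⟨a, b, hab, hab0⟩ := H2 J₀ hJ₀
      have hb : b = 0 := by
        by_contra hb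
        exact hcon J₀ hJ₀ b hb (by rw [hab, hab0.resolve_right hb])
      rw [hab, hb, Submodule.mem_span_singleton]
      exact ⟨a, by rw [hΦsmul, mul_zero, mul_one]⟩).2
    rw [Submodule.mem_span_singleton] at hmem
    obtain ⟨t, ht⟩ := hmem
    rw [hΦsmul, mul_zero, mul_one] at ht
    exact one_ne_zero (hΦinj _ _ _ _ ht).2.symm
  -- … their sum is a rational invariant form of non-zero determinant.
  obtain ⟨J₁, hJ₁, a, ha, hJ₁e⟩ := HA
  obtain ⟨J₂, hJ₂, b, hb, hJ₂e⟩ := HB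
  have hd : ((J₁ + J₂).map φ).det = 0 := by
    rw [← RingHom.mapMatrix_apply, ← RingHom.map_det, H _ (isAltInv_add hJ₁ hJ₂), map_zero]
  have hadd : (J₁ + J₂).map φ = J₁.map φ + J₂.map φ := map_add φ.mapMatrix J₁ J₂
  rw [hadd, hJ₁e, hJ₂e, hΦadd, add_zero, zero_add, hΦdet] at hd
  exact mul_ne_zero (pow_ne_zero _ hdet_ne) (mul_ne_zero (pow_ne_zero _ ha) (pow_ne_zero _ hb)) hd

end Blocks

/-! ## The registered stub -/

/-- **Stub 2 (`stub_symplecticFormFp`).**  `p` odd; `σ, σ'` irreducible, NON-CONJUGATE, with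
`det σ = det σ' = ε̄⁻¹` (`DetCond`); `ρb` an `𝔽_p`-model of `σ ⊕ σ'` (`IsModelOf`).  Then `ρb` is
SYMPLECTIC with multiplier `ε̄⁻¹` over `𝔽_p`: some alternating `J ∈ M₄(𝔽_p)` with `det J` a unit has
`ρb(g)ᵀ J ρb(g) = ε̄(g)⁻¹ J` (`IsSymplecticWithMultiplierFun`, verbatim the first clause of LTWS
`Switchable`).  Proof: `exists_isAltInv_det_ne_zero` with `K₀ = 𝔽_p`, `φ = ZMod.castHom`, `M₀ = ρb`,
`c = ε̄⁻¹`. [cite: BoxerEtAl2021, §2.1 (GSp₄ and its similitude); Isaacs1976, Cor. 9.22] -/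
theorem stub_symplecticFormFp :
    ∀ (p : ℕ) [Fact p.Prime], p ≠ 2 → ∀ (k : Type) [Field k] [CharP k p] [IsAlgClosed k]
      [TopologicalSpace k] [DiscreteTopology k] (σ σ' : FramedGaloisRep ℚ k 2)
      (ρb : FramedGaloisRep ℚ (ZMod p) 4),
      σ.toGaloisRep.IsIrreducible → σ'.toGaloisRep.IsIrreducible →
      DetCond p σ σ' → NonConj σ σ' → IsModelOf ρb σ σ' →
      ρb.IsSymplecticWithMultiplierFun (fun g => (((epsBar p g)⁻¹ : (ZMod p)ˣ) : ZMod p)) := by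
  intro p _ hp k _ _ _ _ _ σ σ' ρb hirr hirr' hdet hnc hmodel
  obtain ⟨h, hh⟩ := hmodel
  have h2 : (2 : k) ≠ 0 := two_ne_zero_of_charP_ne_two k p hp
  set φ : ZMod p →+* k := ZMod.castHom (dvd_refl p) k
  set c : Field.absoluteGaloisGroup ℚ → ZMod p := fun g => (((epsBar p g)⁻¹ : (ZMod p)ˣ) : ZMod p)
  have hval : ∀ {τ : FramedGaloisRep ℚ k 2} {g : Field.absoluteGaloisGroup ℚ},
      FramedRep.det τ g = (Units.map φ.toMonoidHom (epsBar p g))⁻¹ → (τ g).val.det = φ (c g) :=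
    fun {τ g} e1 => by
    have e2 := congr_arg Units.val e1
    rw [← map_inv, Units.coe_map, FramedRep.det_apply, Matrix.GeneralLinearGroup.val_det_apply] at e2
    exact e2
  obtain ⟨J₀, hJ₀, hJ₀det⟩ := exists_isAltInv_det_ne_zero φ h2 σ σ' hirr' hnc (fun g => (ρb g).val)
    c (fun g => hval (hdet g).1) (fun g => hval ((hdet g).2.trans (hdet g).1)) h
    (fun g => by rw [← hh g]; rfl)
  exact ⟨J₀, hJ₀.1, isUnit_iff_ne_zero.mpr hJ₀det, hJ₀.2⟩

end Summit.Langlands.Langlands.Cruxes.StableYoshidaCongruence.BurkhardtWeddleTwoThreeAnchor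

end
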